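import Summits.Ventures.CertifiedManyBodySolver.Downfold.EmeryVanHoveSubBox
import Summits.Ventures.CertifiedManyBodySolver.Downfold.EmeryVanHoveTableF
import Summits.Ventures.CertifiedManyBodySolver.Downfold.EmeryBoxesKSlicesJ
import HarnessLib

/-!
# YBa₂Cu₃O₆.₅ ortho-II (#177 / M63) plane Cu(2), w12dp rows: the CERTIFIED van Hove (Lifshitz) hole doping of the σ three-band model on the typed 3BE one-body box
# — `x_VH ∈ [0.2284, 0.3333]`

Venture CertifiedManyBodySolver, cell `pub/hubbard-downfold` (stage S1, HUMAN RULINGS D-0096/D-0098: the three-band → one-band reduction error is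
carried explicitly), seat hubbard-downfold-mod-4 (technique B = band level); namespace `Summit.Ventures.CertifiedManyBodySolver.Downfold.Emery`.
Everything PROVED; numerics decided by the kernel (ONE `vhBoxCheck` + two entries of the certified table of `Ψ`, `EmeryVanHoveTableF`).

DEVICE (`EmeryVanHoveFactorisation` / `EmeryVanHoveSubBox`): the σ-model van Hove hole doping `x_VH = 1 − 2·abFilling(ε_VH)` (the hole count per Cu,
relative to the half-filled antibonding band, at which the Fermi level reaches the saddle point `ε_AB(X)`) FACTORISES as `x_VH = 1 − 2Ψ(q)`,
`q = u(1 + u)`, **`u = 2(t_pp + t_pp′)/(Δ_pd + ε_VH)`**, with `Ψ` universal and antitone; `u` is monotone in each band parameter, so the window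
below is CORNER-EXACT up to the table resolution (±0.005 per side, `K = 384` grid).

THE STATEMENT (`yBCO65PlaneBox_xVH`, typed words `emeryBoxYBCO65planeY6K26Src`). For every parameter vector of the box
Δ_pd [1.87, 2.48] × t_pd [1.11, 1.31] × t_pp [0.59, 0.7] × t_pp′ [0.2, 0.3] (one-body rows of YBa₂Cu₃O₆.₅ ortho-II (#177 / M63) plane Cu(2), w12dp rows):
**ε_VH ∈ [1.043, 1.606]** (eV above ε_d), **Δ_pd + ε_VH ∈ [3.034, 3.931]**, **q ∈ [0.5634, 1.0938]**
(i.e. the σ Fermi-surface `−t′/t` AT THE SADDLE ENERGY `ρ = q/(1 + 2q) ∈ [0.2649, 0.3431]`), `x_VH = 1 − 2Ψ(q)`, and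
**`x_VH ∈ [0.2284, 0.3333]`** (table entries `Ψ(14/25) ≤ 56885/147456`, `Ψ(219/200) ≥ 49154/147456`).
Float truth at the two extreme corners (not a theorem): x_VH ∈ [0.2346, 0.3280].

READING (the box file's business; comparators are [float]): see the box file addendum / router/EMERY-FS-WINDOWS.md §x_VH.
WHAT THIS IS NOT: not a statement that the material's parameters ARE in the box (SCREENING-GRADE provenance); `U = 0` band kinematics of the σ
d–p_x–p_y(+t_pp, t_pp′) model; the identification of a material's LIFSHITZ transition with this one-body crossing is the consumer's modelling claim
(correlations and the axial / longer-range one-body channels both move it); no phase sentence. Sources: [HybertsenSchluterChristensen1989, Eq. (1)];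
[AndersenEtAl1995, §6]; [PavariniEtAl2001, Eq. (1)].
-/

noncomputable section

namespace Summit.Ventures.CertifiedManyBodySolver.Downfold.Emery

open Real Set
open Summit.Ventures.CertifiedManyBodySolver.Downfold

/-- **YBa₂Cu₃O₆.₅ ortho-II (#177 / M63) plane Cu(2), w12dp rows — raw-coordinate van Hove certificate**: on Δ_pd [1.87, 2.48] × t_pd [1.11, 1.31] × t_pp [0.59, 0.7] × t_pp′ [0.2, 0.3]: `ε_VH ∈ [1.043, 1.606]`,
`q ∈ [0.5634, 1.0938]`, `x_VH = 1 − 2Ψ(q)` and `x_VH ∈ [0.2284, 0.3333]`. [folklore] -/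
theorem yBCO65PlaneBox_xVH {Δ tpd tpp c : ℝ} (hΔ : Δ ∈ Set.Icc (187 / 100 : ℝ) (62 / 25 : ℝ))
    (ha : tpd ∈ Set.Icc (111 / 100 : ℝ) (131 / 100 : ℝ)) (hb : tpp ∈ Set.Icc (59 / 100 : ℝ) (7 / 10 : ℝ))
    (hc : c ∈ Set.Icc (1 / 5 : ℝ) (3 / 10 : ℝ)) :
    vhEnergy Δ tpd c ∈ Set.Icc (5217 / 5000 : ℝ) (2007 / 1250 : ℝ) ∧ vhRatio Δ tpd tpp c ∈ Set.Icc (2817 / 5000 : ℝ) (5469 / 5000 : ℝ) ∧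
      xVH Δ tpd tpp c = 1 - 2 * vhFrac (vhRatio Δ tpd tpp c) ∧ xVH Δ tpd tpp c ∈ Set.Icc (16843 / 73728 : ℝ) (12287 / 36864 : ℝ) := by
  have h := xVH_window_of_vhBoxCheck
    (Δ₁ := ((187 : ℚ) / 100)) (Δ₂ := ((62 : ℚ) / 25)) (a₁ := ((111 : ℚ) / 100)) (a₂ := ((131 : ℚ) / 100)) (b₁ := ((59 : ℚ) / 100)) (b₂ := ((7 : ℚ) / 10))
    (c₁ := ((1 : ℚ) / 5)) (c₂ := ((3 : ℚ) / 10)) (v₁ := ((5217 : ℚ) / 5000)) (v₂ := ((2007 : ℚ) / 1250)) (e := ((291 : ℚ) / 250)) (E := ((1451 : ℚ) / 1000))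
    (q₁ := ((2817 : ℚ) / 5000)) (q₂ := ((5469 : ℚ) / 5000)) (by decide +kernel)
    (Δ := Δ) (tpd := tpd) (tpp := tpp) (c := c) (by simpa using hΔ) (by simpa using ha) (by simpa using hb) (by simpa using hc)
  obtain ⟨hv, -, hq, -, heq, hwin⟩ := h
  push_cast at hv hq hwin
  have hx := xVH_window_of_table hwin (qa := (14 / 25 : ℝ)) (qb := (219 / 200 : ℝ)) (by norm_num) (by norm_num) vhFrac_14_25.2 vhFrac_219_200.1
  exact ⟨⟨by linarith [hv.1], by linarith [hv.2]⟩, ⟨by linarith [hq.1], by linarith [hq.2]⟩, heq,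
    ⟨by linarith [hx.1], by linarith [hx.2]⟩⟩

/-- The four ONE-BODY rows of `emeryBoxYBCO65planeY6K26Src` (`EmeryBoxesKSlicesJ`) this file reads. [folklore] -/
theorem emeryBoxYBCO65planeY6K26Src_oneBodyRows {p : EmeryCoord → ℝ} (hp : emeryBoxYBCO65planeY6K26Src.Mem p) :
    p .DeltaPd ∈ Set.Icc (187 / 100 : ℝ) (62 / 25 : ℝ) ∧ p .tpd ∈ Set.Icc (111 / 100 : ℝ) (131 / 100 : ℝ) ∧
      p .tpp ∈ Set.Icc (59 / 100 : ℝ) (7 / 10 : ℝ) ∧ p .tppP ∈ Set.Icc (1 / 5 : ℝ) (3 / 10 : ℝ) := by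
  have hΔ := (Entry.mem_ofEnds_iff _ _ _ _ _).1 (hp .DeltaPd ybco65planeY6K26Emery_DeltaKS rfl)
  have ha := (Entry.mem_ofEnds_iff _ _ _ _ _).1 (hp .tpd ybco65planeY6K26Emery_tpd rfl)
  have hb := (Entry.mem_ofEnds_iff _ _ _ _ _).1 (hp .tpp ybco65planeY6K26Emery_tpp rfl)
  have hc := (Entry.mem_ofEnds_iff _ _ _ _ _).1 (hp .tppP ybco65planeY6K26Emery_tppP rfl)
  push_cast at hΔ ha hb hc
  exact ⟨⟨hΔ.1, hΔ.2⟩, ⟨ha.1, ha.2⟩, ⟨hb.1, hb.2⟩, ⟨hc.1, hc.2⟩⟩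

/-- **THE WORD ON THE TYPED BOX `emeryBoxYBCO65planeY6K26Src`**: at every parameter vector the σ three-band van Hove (Lifshitz) hole doping lies in
`[0.2284, 0.3333]` (holes per Cu relative to the half-filled antibonding band). [cite: HybertsenSchluterChristensen1989, Eq. (1) (three-band d–p model)] -/
theorem emeryBoxYBCO65planeY6K26Src_xVH_window :
    HoldsOn (fun p : EmeryCoord → ℝ =>
      xVH (p .DeltaPd) (p .tpd) (p .tpp) (p .tppP) ∈ Set.Icc (16843 / 73728 : ℝ) (12287 / 36864 : ℝ)) emeryBoxYBCO65planeY6K26Src := by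
  intro p hp
  obtain ⟨hΔ, ha, hb, hc⟩ := emeryBoxYBCO65planeY6K26Src_oneBodyRows hp
  exact (yBCO65PlaneBox_xVH hΔ ha hb hc).2.2.2

/-- On `emeryBoxYBCO65planeY6K26Src`: the saddle energy `ε_VH ∈ [1.043, 1.606]` and the ratio `q ∈ [0.5634, 1.0938]` (`−t′/t` at the saddle energy
`∈ [0.2649, 0.3431]`). [folklore] -/
theorem emeryBoxYBCO65planeY6K26Src_vhEnergy_vhRatio_window :
    HoldsOn (fun p : EmeryCoord → ℝ =>
      vhEnergy (p .DeltaPd) (p .tpd) (p .tppP) ∈ Set.Icc (5217 / 5000 : ℝ) (2007 / 1250 : ℝ) ∧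
      vhRatio (p .DeltaPd) (p .tpd) (p .tpp) (p .tppP) ∈ Set.Icc (2817 / 5000 : ℝ) (5469 / 5000 : ℝ)) emeryBoxYBCO65planeY6K26Src := by
  intro p hp
  obtain ⟨hΔ, ha, hb, hc⟩ := emeryBoxYBCO65planeY6K26Src_oneBodyRows hp
  exact (yBCO65PlaneBox_xVH hΔ ha hb hc)|> fun h => ⟨h.1, h.2.1⟩

end Summit.Ventures.CertifiedManyBodySolver.Downfold.Emery
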